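import Literature.NumberTheory.Automorphic.UnitaryGroupArthurTraceThreeSocketsExplicitCM
import HarnessLib

/-!
# `J(f)` for the quasi-split `U(J₃)` of a CM field — EXPLICIT and ANALYTIC-HYPOTHESIS-FREE
(Rogawski, *Automorphic Representations of Unitary Groups in Three Variables* (1990), §2.3 p. 14 «`J(f) = Σ_𝔬 J_𝔬(f)`», (6.1.3)
(regular hyperbolic classes), Prop. 7.2.1–7.2.2 ∕ (7.2.3) (singular classes in the Borel), Prop. 7.3.2 (central ∕ unipotent classes);
Arthur, *A trace formula for reductive groups I*, Duke Math. J. 45 (1978), §8.)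

Topic `NumberTheory/Automorphic`; namespace `Literature.NumberTheory.Automorphic.UnitaryGroup`. THEOREMS ONLY over accepted tree
modules (no definition, no named fact, no instance, no notation, no `sorry`). Item (L5-ω) «`J(f)` EXPLICIT», version of record, of
the T1-qs LAW 5 road of `Cruxes/H413/Lines/F0_T1InnerFormTraceIdentity.lean` (cell `pub/hodgecm-mathlib`, crux H413): ★
`arthurTrace_eq_orbital_add_central_add_singular_add_hyperbolic_explicit_cm` (`UnitaryGroupArthurTraceThreeSocketsExplicitCM`) with
its one remaining analytic letter `hS` — integrability over `X = G(F)\G(𝔸)` of the orbital sums of the singular diagonals `d(a, b, a)`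
— DISCHARGED by ★ `integrable_quotFun_tsum_conjOrbit_singular_cm` (`UnitaryGroupSingularOrbitalTermCM`; Rogawski Prop. 7.2.1).
Binders = ★ `…_explicit_cm`'s minus `hS`; statement = its conclusion verbatim; proof = one application.

## References

* J. D. Rogawski, *Automorphic Representations of Unitary Groups in Three Variables*, Ann. of Math. Stud. 123 (1990), §2.3 (p. 14),
  §6.1 (pp. 79–81), §7.2–§7.3 (pp. 91–97) [Rogawski1990].
* J. Arthur, *A trace formula for reductive groups I*, Duke Math. J. 45 (1978), §8 [Arthur1978TraceFormulaI].
-/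

set_option autoImplicit false

noncomputable section

open MeasureTheory Measure NumberField IsDedekindDomain Set Matrix Polynomial
open Literature.MeasureTheory.Group
open Literature.NumberTheory.Automorphic.Meyer
open Literature.NumberTheory.QuadraticForms (normIdeles)
open scoped NNReal ENNReal Classical MatrixGroups

namespace Literature.NumberTheory.Automorphic

namespace UnitaryGroup

/-- **`J(f)` EXPLICIT AT THE CM PIN, NO ANALYTIC HYPOTHESIS** [Rogawski1990, §2.3 (p. 14), (6.1.3), Prop. 7.2.1–7.2.2,
Prop. 7.3.2]. For a test function `f` on the quasi-split `U(J₃)(𝔸)` of a CM field `L`, Arthur's `J(f)` equals the elliptic orbital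
sum plus, for suitable representatives of the three kinds of classes meeting `B(L⁺)`:
`Σ_{central i} (μ(X)·f(z_i·1) + c_μ·(Cc_i + B_i))` [Prop. 7.3.2 (a)–(e), constants `(C₀, C₁, C₂)_i = (zrep i).2`]
`+ Σ_{singular i} 𝔅_i` [Prop. 7.2.2; `𝔅_i = (srep i).2.2` the constant of ★ `truncatedTraceClass_singular_eq_mul_log_add_cm`]
`− c_μ·C_w·Σ_{hyperbolic i} J^v(hyrep i, f)` [(6.1.3)] — ★ `arthurTrace_eq_orbital_add_central_add_singular_add_hyperbolic_explicit_cm`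
with its letter `hS` discharged by ★ `integrable_quotFun_tsum_conjOrbit_singular_cm` at `γ₀ := ι(g₀)` (Prop. 7.2.1: the singular
semisimple orbital sums are integrable over `X`). [cite: Rogawski1990, §2.3 (p. 14), §6.1 (6.1.3), Prop. 7.2.1, Prop. 7.2.2,
Prop. 7.3.2 (pp. 91–97)] [cite: Arthur1978TraceFormulaI, §8] -/
theorem arthurTrace_eq_explicit_cm (L : Type) [Field L] [NumberField L] [IsCMField L]
    [instMA : MeasurableSpace (quasiSplit (↥(maximalRealSubfield L)) L (IsCMField.complexConj L) 3).Adelic] [instBA : BorelSpace (quasiSplit (↥(maximalRealSubfield L)) L (IsCMField.complexConj L) 3).Adelic]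
    (ν : Measure (quasiSplit (↥(maximalRealSubfield L)) L (IsCMField.complexConj L) 3).Adelic) [instν : IsHaarMeasure ν]
    (μ : Measure (quasiSplit (↥(maximalRealSubfield L)) L (IsCMField.complexConj L) 3).automorphicQuotient)
    [instμ : (quasiSplit (↥(maximalRealSubfield L)) L (IsCMField.complexConj L) 3).IsAutomorphicMeasure μ]
    [instMU : MeasurableSpace (adelicUnipotent (↥(maximalRealSubfield L)) L (IsCMField.complexConj L) 3)]
    [instBU : BorelSpace (adelicUnipotent (↥(maximalRealSubfield L)) L (IsCMField.complexConj L) 3)]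
    [instMQ : ∀ γ : (quasiSplit (↥(maximalRealSubfield L)) L (IsCMField.complexConj L) 3).Adelic,
      MeasurableSpace ((quasiSplit (↥(maximalRealSubfield L)) L (IsCMField.complexConj L) 3).Adelic ⧸
        Subgroup.centralizer ({γ} : Set (quasiSplit (↥(maximalRealSubfield L)) L (IsCMField.complexConj L) 3).Adelic))]
    [instBQ : ∀ γ : (quasiSplit (↥(maximalRealSubfield L)) L (IsCMField.complexConj L) 3).Adelic,
      BorelSpace ((quasiSplit (↥(maximalRealSubfield L)) L (IsCMField.complexConj L) 3).Adelic ⧸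
        Subgroup.centralizer ({γ} : Set (quasiSplit (↥(maximalRealSubfield L)) L (IsCMField.complexConj L) 3).Adelic))]
    [instMS : ∀ γ : (quasiSplit (↥(maximalRealSubfield L)) L (IsCMField.complexConj L) 3).Adelic,
      MeasurableSpace (↥(Subgroup.centralizer ({γ} : Set (quasiSplit (↥(maximalRealSubfield L)) L (IsCMField.complexConj L) 3).Adelic)) ⧸
        ((quasiSplit (↥(maximalRealSubfield L)) L (IsCMField.complexConj L) 3).quotientSubgroup ⊓
          Subgroup.centralizer ({γ} : Set (quasiSplit (↥(maximalRealSubfield L)) L (IsCMField.complexConj L) 3).Adelic)).subgroupOf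
          (Subgroup.centralizer ({γ} : Set (quasiSplit (↥(maximalRealSubfield L)) L (IsCMField.complexConj L) 3).Adelic)))]
    [instBS : ∀ γ : (quasiSplit (↥(maximalRealSubfield L)) L (IsCMField.complexConj L) 3).Adelic,
      BorelSpace (↥(Subgroup.centralizer ({γ} : Set (quasiSplit (↥(maximalRealSubfield L)) L (IsCMField.complexConj L) 3).Adelic)) ⧸
        ((quasiSplit (↥(maximalRealSubfield L)) L (IsCMField.complexConj L) 3).quotientSubgroup ⊓
          Subgroup.centralizer ({γ} : Set (quasiSplit (↥(maximalRealSubfield L)) L (IsCMField.complexConj L) 3).Adelic)).subgroupOf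
          (Subgroup.centralizer ({γ} : Set (quasiSplit (↥(maximalRealSubfield L)) L (IsCMField.complexConj L) 3).Adelic)))]
    (ν₀ : Measure (adelicUnipotent (↥(maximalRealSubfield L)) L (IsCMField.complexConj L) 3)) [instν₀ : ν₀.IsHaarMeasure]
    (𝓕 : Set (adelicUnipotent (↥(maximalRealSubfield L)) L (IsCMField.complexConj L) 3))
    (h𝓕 : IsFundamentalDomain (rationalUnipotent (↥(maximalRealSubfield L)) L (IsCMField.complexConj L) 3) 𝓕 ν₀)
    (rep : ConjClasses ↥(quasiSplit (↥(maximalRealSubfield L)) L (IsCMField.complexConj L) 3).arithmeticSubgroup → ↥(quasiSplit (↥(maximalRealSubfield L)) L (IsCMField.complexConj L) 3).arithmeticSubgroup)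
    (hrep : ∀ s, ConjClasses.mk (rep s) = s)
    (νC : ∀ s : ConjClasses ↥(quasiSplit (↥(maximalRealSubfield L)) L (IsCMField.complexConj L) 3).arithmeticSubgroup,
      Measure ↥(Subgroup.centralizer ({((rep s : ↥(quasiSplit (↥(maximalRealSubfield L)) L (IsCMField.complexConj L) 3).arithmeticSubgroup) : (quasiSplit (↥(maximalRealSubfield L)) L (IsCMField.complexConj L) 3).Adelic)} : Set (quasiSplit (↥(maximalRealSubfield L)) L (IsCMField.complexConj L) 3).Adelic)))
    [instνC : ∀ s, IsHaarMeasure (νC s)]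
    (f : (quasiSplit (↥(maximalRealSubfield L)) L (IsCMField.complexConj L) 3).Adelic → ℂ)
    (hf : IsQuasiSplitTest (↥(maximalRealSubfield L)) L (IsCMField.complexConj L) 3 f)
    [MeasurableSpace ((quasiSplit (↥(maximalRealSubfield L)) L (IsCMField.complexConj L) 3).Adelic ⧸
      torusAdelic (↥(maximalRealSubfield L)) L (IsCMField.complexConj L) 3)]
    [BorelSpace ((quasiSplit (↥(maximalRealSubfield L)) L (IsCMField.complexConj L) 3).Adelic ⧸
      torusAdelic (↥(maximalRealSubfield L)) L (IsCMField.complexConj L) 3)]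
    (ρ : Measure ↥(torusAdelic (↥(maximalRealSubfield L)) L (IsCMField.complexConj L) 3)) [ρ.IsHaarMeasure] [ρ.IsInvInvariant]
    {w : (quasiSplit (↥(maximalRealSubfield L)) L (IsCMField.complexConj L) 3).Rational}
    (hw : ((w.1 : GL (Fin 3) L) : Matrix (Fin 3) (Fin 3) L) = !![(0 : L), 0, 1; 0, 1, 0; 1, 0, 0])
    {Cw : ℝ≥0∞} (hC : Cw ≠ ⊤)
    (hwin : ∀ β' : torusInBorel (↥(maximalRealSubfield L)) L (IsCMField.complexConj L) 3 → ℝ≥0∞,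
        IsCoveringWeight ((rationalBorel (↥(maximalRealSubfield L)) L (IsCMField.complexConj L) 3).subgroupOf
          (torusInBorel (↥(maximalRealSubfield L)) L (IsCMField.complexConj L) 3)) β' →
        ∀ A B : ℝ≥0, 0 < A → A ≤ B →
          ∫⁻ s : torusInBorel (↥(maximalRealSubfield L)) L (IsCMField.complexConj L) 3, β' s *
            {s : torusInBorel (↥(maximalRealSubfield L)) L (IsCMField.complexConj L) 3 |
              A < borelHeight (((s : torusInBorel (↥(maximalRealSubfield L)) L (IsCMField.complexConj L) 3) :
                borelAdelic (↥(maximalRealSubfield L)) L (IsCMField.complexConj L) 3) :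
                (quasiSplit (↥(maximalRealSubfield L)) L (IsCMField.complexConj L) 3).Adelic) ∧
              borelHeight (((s : torusInBorel (↥(maximalRealSubfield L)) L (IsCMField.complexConj L) 3) :
                borelAdelic (↥(maximalRealSubfield L)) L (IsCMField.complexConj L) 3) :
                (quasiSplit (↥(maximalRealSubfield L)) L (IsCMField.complexConj L) 3).Adelic) ≤ B}.indicator 1 s
            ∂(Measure.map (⇑(Subgroup.subgroupOfEquivOfLe
              (torusAdelic_le_borelAdelic (F := ↥(maximalRealSubfield L)) (E := L) (c := IsCMField.complexConj L) (N := 3))).symm) ρ :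
                Measure (torusInBorel (↥(maximalRealSubfield L)) L (IsCMField.complexConj L) 3)) =
            Cw * ENNReal.ofReal (Real.log (B : ℝ) - Real.log (A : ℝ)))
    -- the letters of the central closer (★ `truncatedTraceClass_central_eq_linear_cm`) and of the singular closer
    [MeasurableSpace (AdeleRing (𝓞 L) L)] [BorelSpace (AdeleRing (𝓞 L) L)]
    [MeasurableSpace (GaloisRepresentations.ideleGroup L)] [BorelSpace (GaloisRepresentations.ideleGroup L)]
    [MeasurableSpace (AdeleRing (𝓞 (↥(maximalRealSubfield L))) (↥(maximalRealSubfield L)))ˣ]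
    [BorelSpace (AdeleRing (𝓞 (↥(maximalRealSubfield L))) (↥(maximalRealSubfield L)))ˣ]
    {β : (quasiSplit (↥(maximalRealSubfield L)) L (IsCMField.complexConj L) 3).Adelic → ℝ≥0∞}
    (hβ : IsCoveringWeight ((arithmeticBorel (↥(maximalRealSubfield L)) L (IsCMField.complexConj L) 3).map (quasiSplit (↥(maximalRealSubfield L)) L (IsCMField.complexConj L) 3).arithmeticSubgroup.subtype) β)
    (μB : Measure (borelAdelic (↥(maximalRealSubfield L)) L (IsCMField.complexConj L) 3)) [μB.IsHaarMeasure]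
    (μK : Measure ((standardMaximalCompactGL 3 L).comap
      (adelicVal (↥(maximalRealSubfield L)) L (IsCMField.complexConj L) 3 ((StdForm.antidiagonal 3).over L)) : Subgroup (quasiSplit (↥(maximalRealSubfield L)) L (IsCMField.complexConj L) 3).Adelic))
    [μK.IsHaarMeasure]
    (μT : Measure (torusInBorel (↥(maximalRealSubfield L)) L (IsCMField.complexConj L) 3)) [μT.IsHaarMeasure]
    (μX : Measure (AdeleRing (𝓞 L) L)) [μX.IsAddHaarMeasure]
    (μY : Measure (traceZeroAdele (↥(maximalRealSubfield L)) L (IsCMField.complexConj L))) [μY.IsAddHaarMeasure]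
    {wT : torusInBorel (↥(maximalRealSubfield L)) L (IsCMField.complexConj L) 3 → ℝ≥0∞}
    (hwT : IsCoveringWeight ((((quasiSplit (↥(maximalRealSubfield L)) L (IsCMField.complexConj L) 3).arithmeticSubgroup).subgroupOf (borelAdelic (↥(maximalRealSubfield L)) L (IsCMField.complexConj L) 3)).subgroupOf
      (torusInBorel (↥(maximalRealSubfield L)) L (IsCMField.complexConj L) 3)) wT)
    {δ : L} (hcδ : (IsCMField.complexConj L) δ = -δ) (hδ : δ ≠ 0) (θ : 𝓞 (↥(maximalRealSubfield L))) (hθ : θ ≠ 0)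
    (hd : δ * δ = algebraMap (↥(maximalRealSubfield L)) L (θ : (↥(maximalRealSubfield L))))
    (μF : Measure (AdeleRing (𝓞 (↥(maximalRealSubfield L))) (↥(maximalRealSubfield L)))ˣ) [IsHaarMeasure μF]
    (νI : Measure (GaloisRepresentations.ideleGroup L)) [νI.IsHaarMeasure]
    {𝓕E : Set (GaloisRepresentations.ideleGroup L)} (h𝓕E : IsIdeleClassDomain L 𝓕E) :
    haveI := t2Space_quasiSplitAdelic (F := ↥(maximalRealSubfield L)) (E := L) (c := IsCMField.complexConj L) (N := 3)
    haveI := locallyCompactSpace_quasiSplitAdelic (F := ↥(maximalRealSubfield L)) (E := L) (c := IsCMField.complexConj L) (N := 3)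
    haveI := secondCountableTopology_quasiSplitAdelic (F := ↥(maximalRealSubfield L)) (E := L) (c := IsCMField.complexConj L) (N := 3)
    haveI : IsClosed (((quasiSplit (↥(maximalRealSubfield L)) L (IsCMField.complexConj L) 3).quotientSubgroup : Set (quasiSplit (↥(maximalRealSubfield L)) L (IsCMField.complexConj L) 3).Adelic)) :=
      isClosed_quotientSubgroup_quasiSplit
    haveI : ∀ γ : (quasiSplit (↥(maximalRealSubfield L)) L (IsCMField.complexConj L) 3).Adelic, IsClosed ((Subgroup.centralizer ({γ} : Set (quasiSplit (↥(maximalRealSubfield L)) L (IsCMField.complexConj L) 3).Adelic) :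
        Subgroup (quasiSplit (↥(maximalRealSubfield L)) L (IsCMField.complexConj L) 3).Adelic) : Set (quasiSplit (↥(maximalRealSubfield L)) L (IsCMField.complexConj L) 3).Adelic) := isClosed_centralizer_quasiSplit
    haveI : ∀ γ : (quasiSplit (↥(maximalRealSubfield L)) L (IsCMField.complexConj L) 3).Adelic, (count : Measure ↥(((quasiSplit (↥(maximalRealSubfield L)) L (IsCMField.complexConj L) 3).quotientSubgroup ⊓
        Subgroup.centralizer ({γ} : Set (quasiSplit (↥(maximalRealSubfield L)) L (IsCMField.complexConj L) 3).Adelic)).subgroupOf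
          (Subgroup.centralizer ({γ} : Set (quasiSplit (↥(maximalRealSubfield L)) L (IsCMField.complexConj L) 3).Adelic)))).IsHaarMeasure :=
      isHaarMeasure_count_inf_centralizer_subgroupOf_quasiSplit
    haveI : (count : Measure (quasiSplit (↥(maximalRealSubfield L)) L (IsCMField.complexConj L) 3).quotientSubgroup).IsHaarMeasure :=
      isHaarMeasure_count_quotientSubgroup_quasiSplit
    haveI : ν.IsMulRightInvariant := isMulRightInvariant_quasiSplit_cm_three L ν
    letI := AdelicGroupData.measurableSpaceQuotientForm (quasiSplit (↥(maximalRealSubfield L)) L (IsCMField.complexConj L) 3)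
    haveI := AdelicGroupData.borelSpaceQuotientForm (quasiSplit (↥(maximalRealSubfield L)) L (IsCMField.complexConj L) 3)
    haveI := AdelicGroupData.smulInvariantMeasureQuotientForm (quasiSplit (↥(maximalRealSubfield L)) L (IsCMField.complexConj L) 3) μ
    haveI := AdelicGroupData.isFiniteMeasureOnCompactsQuotientForm (quasiSplit (↥(maximalRealSubfield L)) L (IsCMField.complexConj L) 3) μ
    ∃ (zrep : (AdeleRing (𝓞 L) L)[X] × Bool → ratOne (↥(maximalRealSubfield L)) L (IsCMField.complexConj L) × (ℝ≥0 × ℝ × ℝ≥0∞))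
      (srep : (AdeleRing (𝓞 L) L)[X] × Bool → (Lˣ × Lˣ) × (ℂ × ℂ))
      (hyrep : (AdeleRing (𝓞 L) L)[X] × Bool → (quasiSplit (↥(maximalRealSubfield L)) L (IsCMField.complexConj L) 3).Rational),
      ∀ T : ℝ≥0, arthurTrace μ ν₀ 𝓕 f =
        (∑ i ∈ (((finite_setOf_borelRefine_charpoly_of_isCompact (F := ↥(maximalRealSubfield L)) (E := L) (c := IsCMField.complexConj L) (N := 3)
          hf.hasCompactSupport'.isCompact).toFinset).filter (fun i => ∀ β : ↥(arithmeticBorel (↥(maximalRealSubfield L)) L (IsCMField.complexConj L) 3),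
            (((adelicVal (↥(maximalRealSubfield L)) L (IsCMField.complexConj L) 3 _ ((β : ↥(quasiSplit (↥(maximalRealSubfield L)) L (IsCMField.complexConj L) 3).arithmeticSubgroup) : (quasiSplit (↥(maximalRealSubfield L)) L (IsCMField.complexConj L) 3).Adelic) :
                GL (Fin 3) (AdeleRing (𝓞 L) L)) : Matrix (Fin 3) (Fin 3) (AdeleRing (𝓞 L) L)).charpoly,
              decide (∃ δ : ↥(quasiSplit (↥(maximalRealSubfield L)) L (IsCMField.complexConj L) 3).arithmeticSubgroup, δ * (β : ↥(quasiSplit (↥(maximalRealSubfield L)) L (IsCMField.complexConj L) 3).arithmeticSubgroup) * δ⁻¹ ∈ arithmeticBorel (↥(maximalRealSubfield L)) L (IsCMField.complexConj L) 3)) ≠ i)).attach,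
          ((unfoldingConstant (quasiSplit (↥(maximalRealSubfield L)) L (IsCMField.complexConj L) 3).quotientSubgroup
              (count : Measure (quasiSplit (↥(maximalRealSubfield L)) L (IsCMField.complexConj L) 3).quotientSubgroup) μ ν : ℝ) : ℂ) *
            ∑' s : {s : ConjClasses ↥(quasiSplit (↥(maximalRealSubfield L)) L (IsCMField.complexConj L) 3).arithmeticSubgroup //
                (((adelicVal (↥(maximalRealSubfield L)) L (IsCMField.complexConj L) 3 _ ((rep s : ↥(quasiSplit (↥(maximalRealSubfield L)) L (IsCMField.complexConj L) 3).arithmeticSubgroup) : (quasiSplit (↥(maximalRealSubfield L)) L (IsCMField.complexConj L) 3).Adelic) :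
                GL (Fin 3) (AdeleRing (𝓞 L) L)) : Matrix (Fin 3) (Fin 3) (AdeleRing (𝓞 L) L)).charpoly,
              decide (∃ δ : ↥(quasiSplit (↥(maximalRealSubfield L)) L (IsCMField.complexConj L) 3).arithmeticSubgroup, δ * (rep s : ↥(quasiSplit (↥(maximalRealSubfield L)) L (IsCMField.complexConj L) 3).arithmeticSubgroup) * δ⁻¹ ∈ arithmeticBorel (↥(maximalRealSubfield L)) L (IsCMField.complexConj L) 3)) = i.1},
              (haveI : (νC s.1).IsMulRightInvariant :=
                  isMulRightInvariant_centralizer_of_forall_cl_ne (complexConj_mul_complexConj L)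
                    (isConjInvariant_borelRefine isConjInvariant_charpoly_adelicVal) (Finset.mem_filter.1 i.2).2 s.2 (νC s.1);
                haveI : (νC s.1).IsInvInvariant :=
                  isInvInvariant_centralizer_of_forall_cl_ne (complexConj_mul_complexConj L)
                    (isConjInvariant_borelRefine isConjInvariant_charpoly_adelicVal) (Finset.mem_filter.1 i.2).2 s.2 (νC s.1);
                ((quotientMeasure (((quasiSplit (↥(maximalRealSubfield L)) L (IsCMField.complexConj L) 3).quotientSubgroup ⊓
                    Subgroup.centralizer ({((rep s.1 : ↥(quasiSplit (↥(maximalRealSubfield L)) L (IsCMField.complexConj L) 3).arithmeticSubgroup) : (quasiSplit (↥(maximalRealSubfield L)) L (IsCMField.complexConj L) 3).Adelic)} : Set (quasiSplit (↥(maximalRealSubfield L)) L (IsCMField.complexConj L) 3).Adelic)).subgroupOf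
                    (Subgroup.centralizer ({((rep s.1 : ↥(quasiSplit (↥(maximalRealSubfield L)) L (IsCMField.complexConj L) 3).arithmeticSubgroup) : (quasiSplit (↥(maximalRealSubfield L)) L (IsCMField.complexConj L) 3).Adelic)} : Set (quasiSplit (↥(maximalRealSubfield L)) L (IsCMField.complexConj L) 3).Adelic)))
                    count (isClosed_inf_centralizer_subgroupOf_quasiSplit _) (νC s.1) Set.univ).toReal : ℂ) *
                  orbitalIntegral ((rep s.1 : ↥(quasiSplit (↥(maximalRealSubfield L)) L (IsCMField.complexConj L) 3).arithmeticSubgroup) : (quasiSplit (↥(maximalRealSubfield L)) L (IsCMField.complexConj L) 3).Adelic) f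
                    (quotientMeasure (Subgroup.centralizer ({((rep s.1 : ↥(quasiSplit (↥(maximalRealSubfield L)) L (IsCMField.complexConj L) 3).arithmeticSubgroup) : (quasiSplit (↥(maximalRealSubfield L)) L (IsCMField.complexConj L) 3).Adelic)} : Set (quasiSplit (↥(maximalRealSubfield L)) L (IsCMField.complexConj L) 3).Adelic)) (νC s.1)
                      (isClosed_centralizer_quasiSplit _) ν))) +
        ((∑ i ∈ ((finite_setOf_borelRefine_charpoly_of_isCompact (F := ↥(maximalRealSubfield L)) (E := L) (c := IsCMField.complexConj L) (N := 3)
          hf.hasCompactSupport'.isCompact).toFinset).filter (fun i : (AdeleRing (𝓞 L) L)[X] × Bool => i.2 = true ∧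
            ∃ z : Lˣ, (IsCMField.complexConj L) (z : L) * (z : L) = 1 ∧
              i.1 = ((X - C (z : L)) ^ 3).map (algebraMap L (AdeleRing (𝓞 L) L))),

          ((μ.real Set.univ : ℝ) • f ((quasiSplit (↥(maximalRealSubfield L)) L (IsCMField.complexConj L) 3).toAdelic (ratCenter (↥(maximalRealSubfield L)) L (IsCMField.complexConj L) 3 ((StdForm.antidiagonal 3).over L) (zrep i).1)) +
            ((unfoldingConstant (quasiSplit (↥(maximalRealSubfield L)) L (IsCMField.complexConj L) 3).quotientSubgroup
            (count : Measure (quasiSplit (↥(maximalRealSubfield L)) L (IsCMField.complexConj L) 3).quotientSubgroup) μ ν : ℝ) : ℂ) * (((((zrep i).2.1 : ℝ) : ℂ) * ((heisHaar (complexConj_mul_complexConj L) μX μY).real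
              (heisHomeomorph (complexConj_mul_complexConj L) '' (adeleFundamentalDomain L ×ˢ traceZeroFundamentalDomain (↥(maximalRealSubfield L)) L (IsCMField.complexConj L))) : ℂ) *
            ∫ y in ↑(GaloisRepresentations.principalIdeles (↥(maximalRealSubfield L)) ⊔ normIdeles (↥(maximalRealSubfield L)) (θ : (↥(maximalRealSubfield L)))),
              (((IdeleClassGroup.ideleNorm (↥(maximalRealSubfield L)) y ^ 2)⁻¹ : ℝ≥0) : ℝ) •
                ∫ k, f ((k : (quasiSplit (↥(maximalRealSubfield L)) L (IsCMField.complexConj L) 3).Adelic)⁻¹ * (((quasiSplit (↥(maximalRealSubfield L)) L (IsCMField.complexConj L) 3).toAdelic (ratCenter (↥(maximalRealSubfield L)) L (IsCMField.complexConj L) 3 ((StdForm.antidiagonal 3).over L) (zrep i).1)) *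
                  ((heisChart (complexConj_mul_complexConj L) ((0 : AdeleRing (𝓞 L) L),
                      traceZeroLine (↥(maximalRealSubfield L)) L (IsCMField.complexConj L) hcδ hδ (((y⁻¹ : (AdeleRing (𝓞 (↥(maximalRealSubfield L))) (↥(maximalRealSubfield L)))ˣ)) : AdeleRing (𝓞 (↥(maximalRealSubfield L))) (↥(maximalRealSubfield L)))) :
                    adelicUnipotent (↥(maximalRealSubfield L)) L (IsCMField.complexConj L) 3) : (quasiSplit (↥(maximalRealSubfield L)) L (IsCMField.complexConj L) 3).Adelic)) * (k : (quasiSplit (↥(maximalRealSubfield L)) L (IsCMField.complexConj L) 3).Adelic)) ∂μK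
              ∂μF) +
          ((((zrep i).2.2.1 : ℝ) : ℂ) * ((μX.real (adeleFundamentalDomain L) : ℂ) * (((zrep i).2.2.2).toReal : ℂ)) *
            (((∫ x in {x | 1 ≤ (IdeleClassGroup.ideleNorm L x : ℝ)} ∩ 𝓕E,
                  ideleSum L (fun x => ∫ y' : traceZeroAdele (↥(maximalRealSubfield L)) L (IsCMField.complexConj L),
        (∫ k, f ((k : (quasiSplit (↥(maximalRealSubfield L)) L (IsCMField.complexConj L) 3).Adelic)⁻¹ * (((quasiSplit (↥(maximalRealSubfield L)) L (IsCMField.complexConj L) 3).toAdelic (ratCenter (↥(maximalRealSubfield L)) L (IsCMField.complexConj L) 3 ((StdForm.antidiagonal 3).over L) (zrep i).1)) *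
          (((heisChart (complexConj_mul_complexConj L) (x, y')) : adelicUnipotent (↥(maximalRealSubfield L)) L (IsCMField.complexConj L) 3) :
              (quasiSplit (↥(maximalRealSubfield L)) L (IsCMField.complexConj L) 3).Adelic)) * (k : (quasiSplit (↥(maximalRealSubfield L)) L (IsCMField.complexConj L) 3).Adelic)) ∂μK) ∂μY) x * ((IdeleClassGroup.ideleNorm L x : ℝ) : ℂ) ∂νI) +
                ((μX (adeleFundamentalDomain L)).toReal⁻¹ : ℂ) *
                  (∫ x in {x | 1 ≤ (IdeleClassGroup.ideleNorm L x : ℝ)} ∩ 𝓕E,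
                    ideleSum L (adeleFourier L μX (fun x => ∫ y' : traceZeroAdele (↥(maximalRealSubfield L)) L (IsCMField.complexConj L),
        (∫ k, f ((k : (quasiSplit (↥(maximalRealSubfield L)) L (IsCMField.complexConj L) 3).Adelic)⁻¹ * (((quasiSplit (↥(maximalRealSubfield L)) L (IsCMField.complexConj L) 3).toAdelic (ratCenter (↥(maximalRealSubfield L)) L (IsCMField.complexConj L) 3 ((StdForm.antidiagonal 3).over L) (zrep i).1)) *
          (((heisChart (complexConj_mul_complexConj L) (x, y')) : adelicUnipotent (↥(maximalRealSubfield L)) L (IsCMField.complexConj L) 3) :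
              (quasiSplit (↥(maximalRealSubfield L)) L (IsCMField.complexConj L) 3).Adelic)) * (k : (quasiSplit (↥(maximalRealSubfield L)) L (IsCMField.complexConj L) 3).Adelic)) ∂μK) ∂μY)) x ∂νI) -
                ((idelicCovolume L νI).toReal : ℂ) * (fun x => ∫ y' : traceZeroAdele (↥(maximalRealSubfield L)) L (IsCMField.complexConj L),
        (∫ k, f ((k : (quasiSplit (↥(maximalRealSubfield L)) L (IsCMField.complexConj L) 3).Adelic)⁻¹ * (((quasiSplit (↥(maximalRealSubfield L)) L (IsCMField.complexConj L) 3).toAdelic (ratCenter (↥(maximalRealSubfield L)) L (IsCMField.complexConj L) 3 ((StdForm.antidiagonal 3).over L) (zrep i).1)) *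
          (((heisChart (complexConj_mul_complexConj L) (x, y')) : adelicUnipotent (↥(maximalRealSubfield L)) L (IsCMField.complexConj L) 3) :
              (quasiSplit (↥(maximalRealSubfield L)) L (IsCMField.complexConj L) 3).Adelic)) * (k : (quasiSplit (↥(maximalRealSubfield L)) L (IsCMField.complexConj L) 3).Adelic)) ∂μK) ∂μY) 0) -
              (((idelicCovolume L νI).toReal : ℂ) * (((μX (adeleFundamentalDomain L)).toReal⁻¹ : ℂ) *
                  adeleFourier L μX (fun x => ∫ y' : traceZeroAdele (↥(maximalRealSubfield L)) L (IsCMField.complexConj L),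
        (∫ k, f ((k : (quasiSplit (↥(maximalRealSubfield L)) L (IsCMField.complexConj L) 3).Adelic)⁻¹ * (((quasiSplit (↥(maximalRealSubfield L)) L (IsCMField.complexConj L) 3).toAdelic (ratCenter (↥(maximalRealSubfield L)) L (IsCMField.complexConj L) 3 ((StdForm.antidiagonal 3).over L) (zrep i).1)) *
          (((heisChart (complexConj_mul_complexConj L) (x, y')) : adelicUnipotent (↥(maximalRealSubfield L)) L (IsCMField.complexConj L) 3) :
              (quasiSplit (↥(maximalRealSubfield L)) L (IsCMField.complexConj L) 3).Adelic)) * (k : (quasiSplit (↥(maximalRealSubfield L)) L (IsCMField.complexConj L) 3).Adelic)) ∂μK) ∂μY) 0)) *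
                ((Real.log (borelHeight (1 : (quasiSplit (↥(maximalRealSubfield L)) L (IsCMField.complexConj L) 3).Adelic) : ℝ) : ℝ) : ℂ)))))) +
          (∑ i ∈ ((finite_setOf_borelRefine_charpoly_of_isCompact (F := ↥(maximalRealSubfield L)) (E := L) (c := IsCMField.complexConj L) (N := 3)
          hf.hasCompactSupport'.isCompact).toFinset).filter (fun i : (AdeleRing (𝓞 L) L)[X] × Bool => i.2 = true ∧
            ∃ a b : Lˣ, (IsCMField.complexConj L) (a : L) * (a : L) = 1 ∧ (IsCMField.complexConj L) (b : L) * (b : L) = 1 ∧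
              (a : L) ≠ (b : L) ∧ i.1 = ((X - C (a : L)) ^ 2 * (X - C (b : L))).map (algebraMap L (AdeleRing (𝓞 L) L))),
            (srep i).2.2) +
          (∑ i ∈ ((finite_setOf_borelRefine_charpoly_of_isCompact (F := ↥(maximalRealSubfield L)) (E := L) (c := IsCMField.complexConj L) (N := 3)
          hf.hasCompactSupport'.isCompact).toFinset).filter (fun i : (AdeleRing (𝓞 L) L)[X] × Bool => i.2 = true ∧
            ∃ a b : Lˣ, (IsCMField.complexConj L) (a : L) * (a : L) ≠ 1 ∧ (IsCMField.complexConj L) (b : L) * (b : L) = 1 ∧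
              i.1 = ((X - C (a : L)) * (X - C (b : L)) * (X - C ((IsCMField.complexConj L) (a : L))⁻¹)).map (algebraMap L (AdeleRing (𝓞 L) L))),
            -(((unfoldingConstant (quasiSplit (↥(maximalRealSubfield L)) L (IsCMField.complexConj L) 3).quotientSubgroup
              (count : Measure (quasiSplit (↥(maximalRealSubfield L)) L (IsCMField.complexConj L) 3).quotientSubgroup) μ ν : ℝ) : ℂ) *
            (Cw.toReal : ℂ) *
            ∫ x : (quasiSplit (↥(maximalRealSubfield L)) L (IsCMField.complexConj L) 3).Adelic ⧸
                torusAdelic (↥(maximalRealSubfield L)) L (IsCMField.complexConj L) 3,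
              f ((x.out : (quasiSplit (↥(maximalRealSubfield L)) L (IsCMField.complexConj L) 3).Adelic) *
                  (quasiSplit (↥(maximalRealSubfield L)) L (IsCMField.complexConj L) 3).toAdelic (hyrep i) *
                  (x.out : (quasiSplit (↥(maximalRealSubfield L)) L (IsCMField.complexConj L) 3).Adelic)⁻¹) *
                ((Real.log (borelHeight (x.out : (quasiSplit (↥(maximalRealSubfield L)) L (IsCMField.complexConj L) 3).Adelic)⁻¹) +
                  Real.log (borelHeight ((quasiSplit (↥(maximalRealSubfield L)) L (IsCMField.complexConj L) 3).toAdelic w *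
                    (x.out : (quasiSplit (↥(maximalRealSubfield L)) L (IsCMField.complexConj L) 3).Adelic)⁻¹)) : ℝ) : ℂ)
              ∂(quotientMeasure (torusAdelic (↥(maximalRealSubfield L)) L (IsCMField.complexConj L) 3) ρ isClosed_torusAdelic ν)))) :=
  arthurTrace_eq_orbital_add_central_add_singular_add_hyperbolic_explicit_cm L ν μ ν₀ 𝓕 h𝓕 rep hrep νC f hf ρ hw hC hwin
    hβ μB μK μT μX μY hwT hcδ hδ θ hθ hd μF νI h𝓕E
    (fun _ _ g₀ _ _ hab hg₀ => integrable_quotFun_tsum_conjOrbit_singular_cm L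
      (γ₀ := ⟨(quasiSplit (↥(maximalRealSubfield L)) L (IsCMField.complexConj L) 3).toAdelic g₀, g₀, rfl⟩) hg₀ rfl hab μ hf)

end UnitaryGroup

end Literature.NumberTheory.Automorphic
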